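import Summits.CriticalPhenomena.CardyFormulaZ2.Theorems.CardyFlipRussoCoveringLegStubDomainShiftBalance
import Summits.CriticalPhenomena.CardyFormulaZ2.Theorems.CardyFlipRussoCoveringLegTwins
import Literature.Probability.Percolation.UnionJack
import Literature.Probability.RandomPlanarGeometry.ChordalCurveFamily
import HarnessLib

/-!
# Beffara's odd-shift pairing identity: stub `stub_oddShiftPairing`

Helper file for the crux `UnionJackBeffara.MixedInterpolation` (stmt-CriticalPhenomena-4559) of
route `UnionJackBeffara` (sub-problem `CardyFormulaZ2`), line `registered`
(`Cruxes/MixedInterpolation/Lines/birth.lean`): the registered stub `stub_oddShiftPairing`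
(Stub A, the anchor of the line).

Mathematics (V. Beffara, *Is critical 2D percolation universal?* (2008), §5.2, "shifting the state
of all vertices by one lattice mesh").  On the centred square lattice `G_s = unionJackGraph` with
the covering-adapted embedding `unionJackEmbed` and Beffara's mixed product law
`P_{1/2,q} = prodBernoulli (mixedParam q)`, the lattice translation `T = mixedTranslate (1, 0)` is
an automorphism of `G_s` (`unionJackGraph_eq_gsGraph`, `shift_gs_adj_mixedTranslate`), moves every
embedded site by the one-mesh vector `(1 - i)/2` (`oddShift_unionJackEmbed_mixedTranslate`),
exchanges the even (type II) and odd (type III) face centres and hence transports `P_q` to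
`P_{1-q}`.  Consequently (the tree's termwise transport identity `shift_real_pivotal_translate`
of `Theorems/CardyFlipRussoCoveringLegStubDomainShiftBalance.lean`, read in this frame) the
`P_q`-probability that the centre `inr (f.1 + 1, f.2)` is pivotal for the crude crossing
`cross_δ(R)` of a conformal rectangle `R` equals the `P_{1-q}`-probability that `inr f` is pivotal
for the crude crossing of the translated rectangle `R ⊕ δ(i - 1)/2 = R.map (similarity 1 _ (δ (i-1)/2))`
(`stub_oddShiftPairing`; the preimage of a set under `x ↦ x + δ(1-i)/2` is its image under the
similarity `x ↦ x + δ(i-1)/2`, `oddShift_preimage_eq_image`).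

## References

* V. Beffara, *Is critical 2D percolation universal?*, In and Out of Equilibrium 2, Progr. Probab.
  60 (2008), §5.1–§5.2. [Beffara2008Universal]
-/

noncomputable section

namespace Summit.CriticalPhenomena.CardyFormulaZ2.Cruxes.MixedInterpolation.Registered

open Set MeasureTheory
open Literature.Probability.LatticeModels Literature.Probability.Percolation
open Literature.Probability.RandomPlanarGeometry
open Literature.Barriers.CriticalPhenomena (MixedSite mixedParam mixedTranslate mixedTranslate_inl
  mixedTranslate_inr)
open Summit.CriticalPhenomena.CardyFormulaZ2.Cruxes.CoveringLeg.FiveArmNull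
  (shift_real_pivotal_translate shift_gs_adj_mixedTranslate unionJackGraph_eq_gsGraph)

/-! ### The one-step translation in the covering-adapted Union-Jack frame -/

/-- Beffara's shift `(1, 0)` is an odd lattice vector (it exchanges type-II and type-III centres).
[cite: Beffara2008Universal, §5.2] -/
theorem oddShift_odd : Odd (((1, 0) : ℤ × ℤ).1 + ((1, 0) : ℤ × ℤ).2) := by
  decide

/-- The translation by `(1, 0)` is an automorphism of the centred square lattice
`G_s = unionJackGraph` (which is frame B's `gsGraph`). [cite: Beffara2008Universal, §5.1] -/
theorem oddShift_unionJackGraph_adj (a b : MixedSite) :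
    unionJackGraph.Adj (mixedTranslate (1, 0) a) (mixedTranslate (1, 0) b) ↔ unionJackGraph.Adj a b := by
  rw [unionJackGraph_eq_gsGraph]
  exact shift_gs_adj_mixedTranslate (1, 0) a b

/-- The translation by `(1, 0)` moves every embedded site of the covering-adapted frame by the
one-mesh vector `(1 - i)/2`: `unionJackEmbed (T y) = unionJackEmbed y + (1 - i)/2`.
[cite: Beffara2008Universal, §5.1] -/
theorem oddShift_unionJackEmbed_mixedTranslate (y : MixedSite) :
    unionJackEmbed (mixedTranslate (1, 0) y) = unionJackEmbed y + (1 - Complex.I) / 2 := by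
  rcases y with x | g
  · simp only [mixedTranslate_inl, unionJackEmbed_inl]
    push_cast
    ring
  · simp only [mixedTranslate_inr, unionJackEmbed_inr]
    push_cast
    ring

/-- The preimage of a set under the translation `x ↦ x + δ(1 - i)/2` is its image under the
similarity `x ↦ x + δ(i - 1)/2`. [folklore] -/
theorem oddShift_preimage_eq_image (δ : ℝ) (S : Set ℂ) :
    (fun x : ℂ => x + (δ : ℂ) * ((1 - Complex.I) / 2)) ⁻¹' S =
      (similarity 1 one_ne_zero ((δ : ℂ) * ((Complex.I - 1) / 2))) '' S := by
  ext x
  simp only [Set.mem_preimage, Set.mem_image, similarity_apply, one_mul]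
  constructor
  · intro hx
    exact ⟨_, hx, by ring⟩
  · rintro ⟨y, hy, rfl⟩
    convert hy using 1
    ring

/-- The face one step to the right: `f + (1, 0) = (f.1 + 1, f.2)`. [folklore] -/
theorem oddShift_add (f : ℤ × ℤ) : f + ((1, 0) : ℤ × ℤ) = (f.1 + 1, f.2) :=
  Prod.ext rfl (add_zero _)

/-! ### The pairing identity -/

/-- **Beffara's odd-shift pairing (Stub A of line `registered` of crux `MixedInterpolation`).**
For every `q`, every conformal rectangle `R`, every mesh `δ` and every face `f`: the
`P_{1/2,q}`-probability that the centre `inr (f.1 + 1, f.2)` is pivotal for the crude crossing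
`cross_δ(R) = siteEmbDomainCrossing unionJackGraph unionJackEmbed R.carrier δ (R.arc 0) (R.arc 2)`
equals the `P_{1/2,1-q}`-probability that `inr f` is pivotal for the crude crossing of the
translated rectangle `R ⊕ δ(i - 1)/2`.  Proof: the tree's termwise transport identity
`shift_real_pivotal_translate` for the odd translation `t = (1, 0)` (an automorphism of
`unionJackGraph` acting on `unionJackEmbed` by `w = (1 - i)/2`), whose translated data
`(Ω - δw; A - δw, B - δw)` are the carrier and arcs of `R.map (similarity 1 _ (δ(i-1)/2))`
(`MarkedDomain.carrier_map`, `MarkedDomain.arc_map`, `oddShift_preimage_eq_image`).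
[cite: Beffara2008Universal, §5.2 ("shifting the state of all vertices by one lattice mesh")] -/
theorem stub_oddShiftPairing :
    ∀ (q : unitInterval) (R : Literature.Probability.RandomPlanarGeometry.ConformalRectangle) (δ : ℝ) (f : ℤ × ℤ),
      (prodBernoulli (mixedParam q)).real
          {ω | insert (Sum.inr (f.1 + 1, f.2)) ω ∈
                siteEmbDomainCrossing unionJackGraph unionJackEmbed R.carrier δ (R.arc 0) (R.arc 2) ∧
              ω \ {Sum.inr (f.1 + 1, f.2)} ∉
                siteEmbDomainCrossing unionJackGraph unionJackEmbed R.carrier δ (R.arc 0) (R.arc 2)} =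
        (prodBernoulli (mixedParam (unitInterval.symm q))).real
          {ω | insert (Sum.inr f) ω ∈
                siteEmbDomainCrossing unionJackGraph unionJackEmbed
                  (R.map (similarity 1 one_ne_zero ((δ : ℂ) * ((Complex.I - 1) / 2)))).carrier δ
                  ((R.map (similarity 1 one_ne_zero ((δ : ℂ) * ((Complex.I - 1) / 2)))).arc 0)
                  ((R.map (similarity 1 one_ne_zero ((δ : ℂ) * ((Complex.I - 1) / 2)))).arc 2) ∧
              ω \ {Sum.inr f} ∉
                siteEmbDomainCrossing unionJackGraph unionJackEmbed
                  (R.map (similarity 1 one_ne_zero ((δ : ℂ) * ((Complex.I - 1) / 2)))).carrier δ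
                  ((R.map (similarity 1 one_ne_zero ((δ : ℂ) * ((Complex.I - 1) / 2)))).arc 0)
                  ((R.map (similarity 1 one_ne_zero ((δ : ℂ) * ((Complex.I - 1) / 2)))).arc 2)} := by
  intro q R δ f
  have key := shift_real_pivotal_translate oddShift_odd oddShift_unionJackGraph_adj
    oddShift_unionJackEmbed_mixedTranslate q R.carrier (R.arc 0) (R.arc 2) δ f
  rw [oddShift_add] at key
  rw [key, MarkedDomain.carrier_map, MarkedDomain.arc_map, MarkedDomain.arc_map,
    ← oddShift_preimage_eq_image δ R.carrier, ← oddShift_preimage_eq_image δ (R.arc 0),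
    ← oddShift_preimage_eq_image δ (R.arc 2)]

end Summit.CriticalPhenomena.CardyFormulaZ2.Cruxes.MixedInterpolation.Registered

end
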